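import Literature.AnabelianGeometry.EtaleTheta.RigidOfSetting
import Literature.AnabelianGeometry.EtaleTheta.MonoThetaEnvPowers
import Literature.NumberTheory.GaloisRepresentations.KummerCocycleRepresentatives

/-!
# [EtTh] Def. 2.13 (i): the Kummer part of `D_Y` at the §1/§2 model IS the image of `K^×` under the Kummer map (p. 273 / PDF p. 47)

Mochizuki, *The étale theta function and its Frobenioid-theoretic manifestations*, Publ. RIMS **45**
(2009) [cite: MochizukiEtTh2009, Def 2.13 (i) p.273 (PDF p.47)].  Layer L2 of the abc-iut cell, seat
abc-iut-L2-t11 (gen 3), row R31-b of abc-iut-L2-lead (gen 3) ruling #10 (R79); PROOF-ONLY (no `def`, no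
structure, no `Prop` fact, no instance; nothing landed is edited).

Print (Def. 2.13 (i), p.273 (PDF p.47)): "we have a natural outer action `K^× ↠ (K^×)/(K^×)^N ⥲ H¹(G_K, μ_N)
→ H¹(Π^tp_Y, μ_N) → Out(Π^tp_Y[μ_N])` — where the '`⥲`' is the Kummer map — of `K^×` on `Π^tp_Y[μ_N]` …
`D_Y ⊆ Out(Π^tp_Y[μ_N])` the subgroup generated by the image of `K^×`, `Gal(Y/X)`".  abc-iut-L2-t2's interface
`ThetaEnvData` (`MonoThetaEnv.lean`) types the image of `K^×` as `kummerOut` := the outer automorphisms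
"shift by `δ ∘ (Π^tp_Y ↠ G_K)`" for EVERY function `δ : G_K → μ_N` whose inflation is a `1`-cocycle of
`Π^tp_Y` with BI-CONTINUOUS shift — no Kummer theory, no Krull topology on the abstract `G_K`.  This file
supplies, for the §1/§2 MODEL `thetaEnvData` of abc-iut-L2-t8 (`ThetaEnvOfSetting.lean`: `G := G_K =
K.fixingSubgroup ≤ Gal(ℚ̄_p/ℚ_p)`, `μ_N := μ_N(ℚ̄_p)`, `χ :=` the Galois action), the two inclusions between
`kummerOut` and print's object:
* (⊇, unconditional) `thetaEnvData_kummer_mem_kummerOut`: for every `a ∈ K^×` and every `N`-th root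
  `x ∈ ℚ̄_p^×` of `a`, the Kummer cocycle `σ ↦ σ(x)/x` on `G_K` is `μ_N`-valued, its inflation to `Π^tp_Y̲̲`
  is a continuous `1`-cocycle, and its shift lies in `kummerOut`;
* (⊆, modulo ONE tempered-group input) `thetaEnvData_exists_kummer_of_shift_mem_contMulAut`: every element
  of `kummerOut` is of this form for some `a ∈ K^×`, PROVIDED `Π^tp_Y̲̲ ↠ G_K` is an OPEN map (tempered →
  Krull; hypothesis binder `hopenY`, GAP-LEDGER row G-L2t11-3 — not derivable from the `TemperedCurve` /
  `ThetaSetting` interfaces as typed, which record continuity of the augmentation only).  The Kummer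
  theory is abc-iut-w5-d234's `AlgEquiv.exists_kummer_eq_of_isOpen` (Hilbert 90 + fixed points, Serre
  *Local Fields* X §3 b), `KummerCocycleRepresentatives.lean`), consumed BY NAME.
On the way, the `T`-side half of the "Galois dictionary" of this seat's `Sec5KummerGaloisDictionary.lean`
(binders `e`, `j`, `hj`, `hjN`, `hchi`, `haugY` of `hKumC_of_hilbert90` / `hgeom_of_galoisDictionary`) is
DISCHARGED at the model: `e :=` abc-iut `Literature.FieldTheory.Galois.fixingSubgroupMulEquiv D.K refl :
G_K ≃* Gal(ℚ̄_p/K)`, `j := μ_N(ℚ̄_p) ↪ ℚ̄_p^×`, `hchi` = `galMuN` IS the Galois action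
(`thetaEnvData_chi_smul`), `haugY` = "`Ÿ̲̲ → Y̲̲` is geometric" (`thetaEnvData_augY_surjective`, from
abc-iut-L2-t8's `exists_PiYdd_augY_eq`), `hjN` (`mem_range_rootsOfUnity_subtype`); generic versions over any
`T : ThetaEnvData N` with a dictionary `(e, j)` come first (`ThetaEnvData.exists_kummer_of_shift_mem_contMulAut`,
`ThetaEnvData.exists_shift_mem_kummerOut_of_kummer`).
HONEST FRAMING: kernel-checked statements about the typed §1/§2 model; `hopenY` is a hypothesis, not a
fact; nothing of [EtTh] is asserted unconditionally; typed ≠ proved; no side is taken on anything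
downstream ([IUTchIII] Cor. 3.12).
-/

noncomputable section

namespace Literature.AnabelianGeometry.EtaleTheta

open Literature.AnabelianGeometry.SemiGraphs
open scoped Pointwise

universe u

/-! ### A Krull-topology lemma: `σ ↦ σ(x)` is locally constant on `Gal(L/F)` for `L/F` algebraic -/

/-- For `L/F` algebraic and `x ∈ L^×`, the orbit map `σ ↦ σ • x` on `Aut_F(L)` (Krull topology) with
values in the discrete group `L^×` is locally constant: it is constant on the cosets of the open subgroup
`Gal(L/F(x))` (`F(x)/F` finite).  [cite: NeukirchANT1999, Ch. IV §1] -/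
theorem isLocallyConstant_smul_units_of_isAlgebraic {F L : Type*} [Field F] [Field L] [Algebra F L]
    [Algebra.IsAlgebraic F L] (x : Lˣ) : IsLocallyConstant fun σ : L ≃ₐ[F] L => σ • x := by
  refine IsLocallyConstant.desc _ (Units.val : Lˣ → L) ?_ Units.val_injective
  have hx : IsIntegral F (x : L) := Algebra.IsIntegral.isIntegral _
  haveI : FiniteDimensional F (IntermediateField.adjoin F {(x : L)}) :=
    IntermediateField.adjoin.finiteDimensional hx
  refine (IsLocallyConstant.iff_exists_open _).mpr fun σ =>
    ⟨σ • ((IntermediateField.adjoin F {(x : L)}).fixingSubgroup : Set (L ≃ₐ[F] L)),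
      (IntermediateField.fixingSubgroup_isOpen _).smul σ, ⟨1, Subgroup.one_mem _, by simp⟩, ?_⟩
  rintro _ ⟨τ, hτ, rfl⟩
  change (((σ * τ) • x : Lˣ) : L) = ((σ • x : Lˣ) : L)
  rw [AlgEquiv.smul_units_def, AlgEquiv.smul_units_def, Units.coe_map, Units.coe_map, MonoidHom.coe_coe,
    MonoidHom.coe_coe, AlgEquiv.mul_apply]
  congr 1
  exact (IntermediateField.mem_fixingSubgroup_iff _ _).mp hτ _
    (IntermediateField.mem_adjoin_simple_self F (x : L))

/-! ### Generic: the Kummer part of `D_Y` through a dictionary `(e, j)` for an arbitrary `ThetaEnvData` -/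

namespace ThetaEnvData

variable {N : ℕ+} (T : ThetaEnvData.{u} N) {F : Type*} {L : Type*} [Field F] [Field L] [Algebra F L]
  (e : T.G ≃* (L ≃ₐ[F] L)) (j : T.mu →* Lˣ)

/-- **Every element of `kummerOut` is a Kummer class** (generic form): given a dictionary `e : G ≃* Aut_F(L)`,
`j : μ_N ↪ L^×` equivariant, `Π^tp_Y ↠ G` onto and open onto the Krull topology, every `δ₀ : G → μ_N` whose
inflation to `Π^tp_Y` is a `1`-cocycle with bi-continuous shift is the Kummer cocycle `σ ↦ σ(x)/x` of an
`N`-th root `x` of a constant `a ∈ F^×` — print's "`K^× ↠ (K^×)/(K^×)^N ⥲ H¹(G_K, μ_N)` — where the '`⥲`' is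
the Kummer map".  (Steps: the cocycle descends to `G` since `Π^tp_Y ↠ G` is onto; it is Krull-locally
constant since the shift is bi-continuous (`continuous_of_shift_mem`) and `Π^tp_Y ↠ G` is open; then
abc-iut-w5-d234's `AlgEquiv.exists_kummer_eq_of_isOpen`.)  [cite: MochizukiEtTh2009, Def 2.13 (i) p.273 (PDF p.47)] -/
theorem exists_kummer_of_shift_mem_contMulAut [Normal F L] [NeZero ((N : ℕ) : F)]
    (hj : Function.Injective j) (hchi : ∀ (g : T.G) (x : T.mu), j (T.chi g x) = e g • j x)
    (haugY : Function.Surjective T.augY) (hopen : IsOpenMap fun q : T.PiY => e (T.augY q))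
    (δ₀ : T.G → T.mu) (hδ : CycEnvelope.IsEnvCocycle T.augY T.chi (δ₀ ∘ T.augY))
    (hc : CycEnvelope.shift hδ ∈ contMulAut T.env) :
    ∃ (a : Fˣ) (x : Lˣ), x ^ (N : ℕ) = Units.map (algebraMap F L : F →* L) a ∧
      ∀ g : T.G, j (δ₀ g) = e g • x / x := by
  -- `δ₀` is a `1`-cocycle of `G`
  have hcocG : ∀ g h : T.G, δ₀ (g * h) = δ₀ g * T.chi g (δ₀ h) := by
    intro g h
    obtain ⟨p, rfl⟩ := haugY g
    obtain ⟨q, rfl⟩ := haugY h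
    rw [← map_mul]
    exact hδ p q
  have hcc : ∀ σ τ : L ≃ₐ[F] L,
      j (δ₀ (e.symm (σ * τ))) = σ • j (δ₀ (e.symm τ)) * j (δ₀ (e.symm σ)) := by
    intro σ τ
    rw [map_mul, hcocG, map_mul, hchi, MulEquiv.apply_symm_apply, mul_comm]
  -- `{c = 1}` is Krull-open
  have hcont : Continuous (δ₀ ∘ T.augY) := T.continuous_of_shift_mem hδ hc
  have hU : IsOpen ((δ₀ ∘ T.augY) ⁻¹' {1}) := hcont.isOpen_preimage _ (isOpen_discrete _)
  have hset : {σ : L ≃ₐ[F] L | j (δ₀ (e.symm σ)) = 1} =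
      (fun q : T.PiY => e (T.augY q)) '' ((δ₀ ∘ T.augY) ⁻¹' {1}) := by
    ext σ
    constructor
    · intro hσ
      obtain ⟨q, hq⟩ := haugY (e.symm σ)
      refine ⟨q, ?_, by simp only [hq, MulEquiv.apply_symm_apply]⟩
      change δ₀ (T.augY q) = 1
      apply hj
      rw [hq, map_one]
      exact hσ
    · rintro ⟨q, hq, rfl⟩
      have hq' : δ₀ (T.augY q) = 1 := hq
      change j (δ₀ (e.symm (e (T.augY q)))) = 1
      rw [MulEquiv.symm_apply_apply, hq', map_one]
  have hopen1 : IsOpen {σ : L ≃ₐ[F] L | j (δ₀ (e.symm σ)) = 1} := by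
    rw [hset]
    exact hopen _ hU
  -- Kummer theory at the cocycle level (abc-iut-w5-d234, consumed BY NAME)
  have hN : ∀ z : T.mu, z ^ (N : ℕ) = 1 := fun z => by
    rw [← T.card_mu]
    exact pow_card_eq_one
  obtain ⟨a, x, hxN, hx⟩ :=
    _root_.Literature.NumberTheory.GaloisRepresentations.AlgEquiv.exists_kummer_eq_of_isOpen (N : ℕ)
      (fun σ : L ≃ₐ[F] L => j (δ₀ (e.symm σ))) hcc hopen1 (fun σ => by
        rw [← map_pow, hN, map_one])
  refine ⟨a, x, hxN, fun g => ?_⟩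
  have h : j (δ₀ (e.symm (e g))) = e g • x / x := hx (e g)
  rwa [MulEquiv.symm_apply_apply] at h

/-- **Every Kummer class gives an element of `kummerOut`** (generic form): if `δ₀ : G → μ_N` reads, through an
equivariant injective `j : μ_N ↪ L^×` and `e : G ≃* Aut_F(L)` with `Π^tp_Y → G → Aut_F(L)` continuous, as the
Kummer cocycle `σ ↦ σ(x)/x` of some `x ∈ L^×` (`L/F` algebraic), then its inflation to `Π^tp_Y` is a
`1`-cocycle with bi-continuous shift, which therefore lies in `kummerOut` — print's map
"`H¹(G_K, μ_N) → H¹(Π^tp_Y, μ_N) → Out(Π^tp_Y[μ_N])`".  [cite: MochizukiEtTh2009, Def 2.13 (i) p.273 (PDF p.47)] -/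
theorem exists_shift_mem_kummerOut_of_kummer [Algebra.IsAlgebraic F L] (hj : Function.Injective j)
    (hchi : ∀ (g : T.G) (x : T.mu), j (T.chi g x) = e g • j x)
    (hcont : Continuous fun q : T.PiY => e (T.augY q)) (δ₀ : T.G → T.mu) (x : Lˣ)
    (hx : ∀ g : T.G, j (δ₀ g) = e g • x / x) :
    ∃ (hδ : CycEnvelope.IsEnvCocycle T.augY T.chi (δ₀ ∘ T.augY))
      (hc : CycEnvelope.shift hδ ∈ contMulAut T.env), TopOut.mk _ ⟨_, hc⟩ ∈ T.kummerOut := by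
  -- cocycle law on `G`, read through `j`
  have hcocG : ∀ g h : T.G, δ₀ (g * h) = δ₀ g * T.chi g (δ₀ h) := by
    intro g h
    apply hj
    rw [map_mul, hchi, hx, hx, hx, map_mul, mul_smul, smul_div', div_mul_div_comm, mul_comm (e g • x),
      mul_div_mul_right_eq_div]
  have hδ : CycEnvelope.IsEnvCocycle T.augY T.chi (δ₀ ∘ T.augY) := fun g h => by
    change δ₀ (T.augY (g * h)) = δ₀ (T.augY g) * T.chi (T.augY g) (δ₀ (T.augY h))
    rw [map_mul, hcocG]
  -- continuity: `j ∘ δ₀ ∘ aug = (σ ↦ σ(x)/x) ∘ (e ∘ aug)` is locally constant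
  have hlc : IsLocallyConstant (δ₀ ∘ T.augY) := by
    refine IsLocallyConstant.desc _ j ?_ hj
    have h1 : j ∘ (δ₀ ∘ T.augY) = (fun σ : L ≃ₐ[F] L => σ • x / x) ∘ fun q : T.PiY => e (T.augY q) := by
      funext q
      exact hx (T.augY q)
    rw [h1]
    exact ((isLocallyConstant_smul_units_of_isAlgebraic x).comp (· / x)).comp_continuous hcont
  have hc : CycEnvelope.shift hδ ∈ contMulAut T.env :=
    T.shift_mem_contMulAut_of_continuous hδ hlc.continuous
  exact ⟨hδ, hc, δ₀, hδ, hc, rfl⟩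

end ThetaEnvData

/-! ### At the §1/§2 model `thetaEnvData` (abc-iut-L2-t8): the `T`-side of the dictionary and Def. 2.13 (i) -/

namespace ThetaSetting

namespace EtaleThetaData.DoubleUnderline

variable {p : ℕ} [Fact p.Prime] {D : ThetaSetting p} {E : D.EtaleThetaData} {l : ℕ}
  (C : E.DoubleUnderline l) {N : ℕ+} (μ : D.CyclotomeMod l N) (hC : D.Compat) (hS : D.Sec2Hyps)

/-- **`haugY` at the model: `Π^tp_Y̲̲ ↠ G_K` is onto** ("`Ÿ̲̲ → Y̲̲`, `Y̲̲`, `X̲̲` geometrically connected over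
`K`"; abc-iut-L2-t8's `exists_PiYdd_augY_eq` / the interface field `map_aug_Ydduu`).
[cite: MochizukiEtTh2009, Def 2.7 p.267 (PDF p.41)] -/
theorem thetaEnvData_augY_surjective : Function.Surjective (C.thetaEnvData μ hC hS).augY := by
  intro g
  obtain ⟨k, hk⟩ := C.exists_lift g
  exact ⟨⟨⟨(k : D.PiTemp), (Subgroup.mem_inf.1 k.2).2⟩,
    Subgroup.mem_subgroupOf.2 (D.GtpYdd_le_GtpY (Subgroup.mem_inf.1 k.2).1)⟩, Subtype.ext hk⟩

/-- **`hchi` at the model: the character `χ` of `thetaEnvData` IS the Galois action of `G_K ≤ Gal(ℚ̄_p/ℚ_p)` on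
`μ_N(ℚ̄_p) ⊆ ℚ̄_p^×`** (abc-iut-L2-t8's `galMuN`), read through `e := fixingSubgroupMulEquiv D.K refl :
G_K ≃* Gal(ℚ̄_p/K)` and `j := μ_N(ℚ̄_p) ↪ ℚ̄_p^×` — "the action of `G_K` on `ℤ/Nℤ(1)`".
[cite: MochizukiEtTh2009, Def 2.10 p.270 (PDF p.44)] -/
theorem thetaEnvData_chi_dictionary (g : D.GK) (x : MuN p N) :
    (rootsOfUnity N (PadicAlgCl p)).subtype ((C.thetaEnvData μ hC hS).chi g x) =
      (Literature.FieldTheory.Galois.fixingSubgroupMulEquiv D.K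
          (AlgEquiv.refl : PadicAlgCl p ≃ₐ[D.K] PadicAlgCl p) g) •
        (rootsOfUnity N (PadicAlgCl p)).subtype x := by
  apply Units.ext
  rw [AlgEquiv.smul_units_def, Units.coe_map, MonoidHom.coe_coe,
    Literature.FieldTheory.Galois.fixingSubgroupMulEquiv_apply, AlgEquiv.refl_symm, AlgEquiv.coe_refl,
    id_eq, id_eq]
  exact galMuN_apply_coe p N (g : GQp p) x

/-- The same with the plain `Gal(ℚ̄_p/ℚ_p)`-action: `χ(g)(ζ) = g(ζ)` in `ℚ̄_p^×`.
[cite: MochizukiEtTh2009, Def 2.10 p.270 (PDF p.44)] -/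
theorem thetaEnvData_chi_smul (g : D.GK) (x : MuN p N) :
    (((C.thetaEnvData μ hC hS).chi g x : MuN p N) : (PadicAlgCl p)ˣ) = (g : GQp p) • (x : (PadicAlgCl p)ˣ) := by
  apply Units.ext
  rw [AlgEquiv.smul_units_def, Units.coe_map, MonoidHom.coe_coe]
  exact galMuN_apply_coe p N (g : GQp p) x

/-- **`hjN` at the model**: `μ_N(ℚ̄_p) ↪ ℚ̄_p^×` is onto the `N`-torsion.  [cite: MochizukiEtTh2009, Def 2.10 p.270 (PDF p.44)] -/
theorem mem_range_rootsOfUnity_subtype (z : (PadicAlgCl p)ˣ) (hz : z ^ (N : ℕ) = 1) :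
    z ∈ (rootsOfUnity N (PadicAlgCl p)).subtype.range := by
  rw [Subgroup.range_subtype]
  exact (mem_rootsOfUnity _ _).2 hz

/-- `e ∘ (Π^tp_Y̲̲ ↠ G_K)` is continuous (the augmentation of the tempered group is continuous, and
`fixingSubgroupMulEquiv` is a homeomorphism for the Krull topologies, abc-iut
`Literature.FieldTheory.Galois.continuous_fixingSubgroupMulEquiv`).  [cite: MochizukiEtTh2009, Def 2.13 (i) p.273 (PDF p.47)] -/
theorem continuous_fixingSubgroupMulEquiv_thetaEnvData_augY :
    Continuous fun q : (C.thetaEnvData μ hC hS).PiY =>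
      Literature.FieldTheory.Galois.fixingSubgroupMulEquiv D.K
        (AlgEquiv.refl : PadicAlgCl p ≃ₐ[D.K] PadicAlgCl p) ((C.thetaEnvData μ hC hS).augY q) := by
  refine (Literature.FieldTheory.Galois.continuous_fixingSubgroupMulEquiv D.K _).comp ?_
  exact continuous_induced_rng.2
    (D.aug.continuous.comp (continuous_subtype_val.comp continuous_subtype_val))

/-- **Def. 2.13 (i), inclusion `Im(K^×) ⊆ kummerOut` at the model (unconditional)**: for every `a ∈ K^×` and
every `N`-th root `x ∈ ℚ̄_p^×` of `a`, the Kummer cocycle `σ ↦ σ(x)/x` of `G_K` is `μ_N`-valued, its inflation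
to `Π^tp_Y̲̲` is a continuous `1`-cocycle for `χ`, and its shift is an element of abc-iut-L2-t2's `kummerOut` —
"`K^× ↠ (K^×)/(K^×)^N ⥲ H¹(G_K, μ_N) → H¹(Π^tp_Y, μ_N) → Out(Π^tp_Y[μ_N])`".
[cite: MochizukiEtTh2009, Def 2.13 (i) p.273 (PDF p.47)] -/
theorem thetaEnvData_kummer_mem_kummerOut (a : (D.K)ˣ) (x : (PadicAlgCl p)ˣ)
    (hx : x ^ (N : ℕ) = Units.map (algebraMap D.K (PadicAlgCl p) : D.K →* PadicAlgCl p) a) :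
    ∃ (δ₀ : D.GK → MuN p N)
      (hδ : CycEnvelope.IsEnvCocycle (C.thetaEnvData μ hC hS).augY (C.thetaEnvData μ hC hS).chi
        (δ₀ ∘ (C.thetaEnvData μ hC hS).augY))
      (hc : CycEnvelope.shift hδ ∈ contMulAut (C.thetaEnvData μ hC hS).env),
      (∀ g : D.GK, ((δ₀ g : MuN p N) : (PadicAlgCl p)ˣ) = (g : GQp p) • x / x) ∧
        TopOut.mk _ ⟨_, hc⟩ ∈ (C.thetaEnvData μ hC hS).kummerOut := by
  -- `g(x)/x` is an `N`-th root of unity for `g ∈ G_K` (`g` fixes `a ∈ K`)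
  have hfix : ∀ g : D.GK, (g : GQp p) • Units.map (algebraMap D.K (PadicAlgCl p) : D.K →* PadicAlgCl p) a =
      Units.map (algebraMap D.K (PadicAlgCl p) : D.K →* PadicAlgCl p) a := by
    intro g
    apply Units.ext
    rw [AlgEquiv.smul_units_def, Units.coe_map, MonoidHom.coe_coe, Units.coe_map, MonoidHom.coe_coe]
    exact (IntermediateField.mem_fixingSubgroup_iff _ _).mp g.2 _ (a : D.K).2
  have hmem : ∀ g : D.GK, (g : GQp p) • x / x ∈ rootsOfUnity N (PadicAlgCl p) := by
    intro g
    rw [mem_rootsOfUnity, div_pow, ← smul_pow', hx, hfix, div_self']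
  let δ₀ : D.GK → MuN p N := fun g => ⟨(g : GQp p) • x / x, hmem g⟩
  have hδ₀ : ∀ g : D.GK, ((δ₀ g : MuN p N) : (PadicAlgCl p)ˣ) = (g : GQp p) • x / x := fun _ => rfl
  have hxe : ∀ g : D.GK, (rootsOfUnity N (PadicAlgCl p)).subtype (δ₀ g) =
      Literature.FieldTheory.Galois.fixingSubgroupMulEquiv D.K
        (AlgEquiv.refl : PadicAlgCl p ≃ₐ[D.K] PadicAlgCl p) g • x / x := by
    intro g
    rw [Subgroup.subtype_apply, hδ₀]
    rfl
  obtain ⟨hδ, hc, hmemK⟩ := (C.thetaEnvData μ hC hS).exists_shift_mem_kummerOut_of_kummer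
    (Literature.FieldTheory.Galois.fixingSubgroupMulEquiv D.K
      (AlgEquiv.refl : PadicAlgCl p ≃ₐ[D.K] PadicAlgCl p))
    (rootsOfUnity N (PadicAlgCl p)).subtype (rootsOfUnity N (PadicAlgCl p)).subtype_injective
    (C.thetaEnvData_chi_dictionary μ hC hS) (C.continuous_fixingSubgroupMulEquiv_thetaEnvData_augY μ hC hS)
    δ₀ x hxe
  exact ⟨δ₀, hδ, hc, hδ₀, hmemK⟩

/-- **Def. 2.13 (i), inclusion `kummerOut ⊆ Im(K^×)` at the model, modulo openness of `Π^tp_Y̲̲ ↠ G_K`**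
(`hopenY`, GAP-LEDGER G-L2t11-3): every element of abc-iut-L2-t2's `kummerOut` for `thetaEnvData` — a function
`δ₀ : G_K → μ_N` whose inflation is a `1`-cocycle of `Π^tp_Y̲̲` with bi-continuous shift — is the Kummer cocycle
`σ ↦ σ(x)/x` of an `N`-th root `x ∈ ℚ̄_p^×` of some `a ∈ K^×`: "the image of `K^× ↠ (K^×)/(K^×)^N ⥲
H¹(G_K, μ_N)` — where the '`⥲`' is the Kummer map".  The `T`-side of the dictionary of this seat's
`hKumC_of_hilbert90` / `hgeom_of_galoisDictionary` (`Sec5KummerGaloisDictionary.lean`) is thereby DISCHARGED at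
the model: `e`, `j`, `hj`, `hchi`, `haugY`, `[Normal K ℚ̄_p]`, `[NeZero (N : K)]`; only `hopenY` remains on
this side.  [cite: MochizukiEtTh2009, Def 2.13 (i) p.273 (PDF p.47)] -/
theorem thetaEnvData_exists_kummer_of_shift_mem_contMulAut
    (hopenY : IsOpenMap (C.thetaEnvData μ hC hS).augY) (δ₀ : D.GK → MuN p N)
    (hδ : CycEnvelope.IsEnvCocycle (C.thetaEnvData μ hC hS).augY (C.thetaEnvData μ hC hS).chi
      (δ₀ ∘ (C.thetaEnvData μ hC hS).augY))
    (hc : CycEnvelope.shift hδ ∈ contMulAut (C.thetaEnvData μ hC hS).env) :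
    ∃ (a : (D.K)ˣ) (x : (PadicAlgCl p)ˣ),
      x ^ (N : ℕ) = Units.map (algebraMap D.K (PadicAlgCl p) : D.K →* PadicAlgCl p) a ∧
        ∀ g : D.GK, ((δ₀ g : MuN p N) : (PadicAlgCl p)ˣ) = (g : GQp p) • x / x := by
  haveI : IsAlgClosure D.K (PadicAlgCl p) := Literature.FieldTheory.Galois.isAlgClosure_of_intermediateField D.K
  obtain ⟨a, x, hxN, hx⟩ := (C.thetaEnvData μ hC hS).exists_kummer_of_shift_mem_contMulAut
    (Literature.FieldTheory.Galois.fixingSubgroupMulEquiv D.K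
      (AlgEquiv.refl : PadicAlgCl p ≃ₐ[D.K] PadicAlgCl p))
    (rootsOfUnity N (PadicAlgCl p)).subtype (rootsOfUnity N (PadicAlgCl p)).subtype_injective
    (C.thetaEnvData_chi_dictionary μ hC hS) (C.thetaEnvData_augY_surjective μ hC hS)
    ((Literature.FieldTheory.Galois.fixingSubgroupContinuousMulEquiv D.K
      (AlgEquiv.refl : PadicAlgCl p ≃ₐ[D.K] PadicAlgCl p)).toHomeomorph.isOpenMap.comp hopenY) δ₀ hδ hc
  refine ⟨a, x, hxN, fun g => ?_⟩
  have h := hx g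
  rw [Subgroup.subtype_apply] at h
  rw [h]
  rfl

end EtaleThetaData.DoubleUnderline

end ThetaSetting

end Literature.AnabelianGeometry.EtaleTheta

end
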